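import Mathlib.RingTheory.Artinian.Module
import Mathlib.FieldTheory.PrimitiveElement
import Mathlib.FieldTheory.Perfect
import Mathlib.FieldTheory.IsAlgClosed.Basic
import Mathlib.RingTheory.Adjoin.PowerBasis
import Mathlib.Algebra.MvPolynomial.Eval
import HarnessLib

/-!
# The rational shape lemma for a finite set of points cut out by polynomials over a subfield

Topic `Literature/RingTheory/ZeroDimensional`. Let `k ⊆ K` be fields, `k` perfect and `K`
algebraically closed, and let `V ⊆ Kⁿ` be a FINITE set which is the common zero set of a family
of polynomials with coefficients in `k`, all of whose points have coordinates algebraic over `k`.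
If a linear form `ℓ = ∑ ℓ_i X_i` with coefficients in `k` separates the points of `V`, then

* the monic polynomial `μ = ∏_{z ∈ V} (T - ℓ(z))` has coefficients in `k` (it is the minimal
  polynomial of `ℓ` on `V`), and
* every coordinate is a polynomial in `ℓ` over `k` on `V`: for each `i` there is `v_i ∈ k[T]` of
  degree `< |V|` with `z_i = v_i(ℓ(z))` for all `z ∈ V`

(`exists_rational_shape`). This is the qualitative content of a *geometric resolution* /
*rational univariate representation* of a zero-dimensional variety (Kronecker; Krick–Pardo 1996,
Prop. 27, items (1) "the linear form `ℓ` separates the points of `V`" and (2)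
"`x_i = λ⁻¹ v_i(ℓ(x))` for all `x ∈ V`", as quoted and used by Bürgisser, TCS 235 (2000), proof of
Thm. 4.5, p. 82; Rouillier 1999, Thm. 3.1), without any height or complexity statement.

## Proof

Let `R = k[x̄_1, …, x̄_n] ⊆ K^V` be the `k`-algebra of functions on `V` generated by the coordinate
functions; it is reduced, and finite-dimensional because each `x̄_i` is killed by the product of
the minimal polynomials of the (algebraic) coordinates `z_i`, `z ∈ V`. The points of `V` give
`|V|` distinct `k`-algebra homomorphisms `R → K`, and conversely every homomorphism `R → K` is the
evaluation at a point of `V`, because `V` is cut out by `k`-polynomials, which vanish in `R`.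
A finite reduced commutative algebra over a perfect field is a product of finite separable field
extensions (`IsArtinianRing.equivPi`), so it has exactly `dim_k R` homomorphisms into `K`
(`AlgHom.card`); hence `dim_k R ≤ |V|` (`finrank_le_card_algHom_of_isReduced`). On the other hand
the minimal polynomial `μ` of `ℓ̄ = ∑ ℓ_i x̄_i ∈ R` has the `|V|` distinct roots `ℓ(z)`, so
`|V| ≤ deg μ ≤ dim_k k[ℓ̄] ≤ dim_k R ≤ |V|`: everything is equal, `k[ℓ̄] = R`, each `x̄_i` is a
polynomial in `ℓ̄` of degree `< deg μ = |V|`, and `μ = ∏_{z ∈ V} (T - ℓ(z))`.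

## Content (namespace `Literature.RingTheory.ZeroDimensional`, everything proved)

* `finrank_le_card_algHom_of_isReduced` — a finite reduced commutative algebra over a perfect
  field `k` has at least `dim_k` homomorphisms into an algebraically closed `K ⊇ k`;
* `exists_rational_shape` — the rational shape lemma above.

What is NOT here: the algebraicity of the coordinates (a consequence of the Nullstellensatz for a
finite zero set; it is taken as a hypothesis, and in the arithmetic applications it comes with the
height bounds), the choice of a separating form with small coefficients
(`SeparatingForm.lean`), the integral version and its height bounds (`IntegralShapeLemma.lean`,
`IntegralShapeLemmaBounds.lean`).

## References

* P. Bürgisser, *Cook's versus Valiant's hypothesis*, TCS 235 (2000) 71–88, proof of Thm. 4.5,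
  p. 82 (items (1)–(2) of Krick–Pardo's Prop. 27). [Burgisser2000TCS]
* T. Krick, L. M. Pardo, *A computational method for Diophantine approximation*, Progr. Math.
  143 (1996) 193–253, Prop. 27. [KrickPardo1996]
* F. Rouillier, *Solving zero-dimensional systems through the rational univariate
  representation*, AAECC 9 (1999) 433–461, §3. [Rouillier1999]
-/

noncomputable section

open Polynomial Module

namespace Literature.RingTheory.ZeroDimensional

/-- **A finite reduced commutative algebra over a perfect field has at least as many geometric
points as its dimension** (in fact exactly as many): if `R` is a finite-dimensional reduced
commutative `k`-algebra, `k` perfect, and `K ⊇ k` is algebraically closed, then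
`dim_k R ≤ #Hom_k(R, K)`. Proof: `R` is Artinian and reduced, hence the product of its residue
fields `R ⧸ 𝔪` (`IsArtinianRing.equivPi`), each a finite separable extension of `k` with exactly
`[R ⧸ 𝔪 : k]` embeddings into `K` (`AlgHom.card`); composing with the projections gives distinct
homomorphisms `R → K`. [folklore] -/
theorem finrank_le_card_algHom_of_isReduced (k R K : Type*) [Field k] [PerfectField k]
    [CommRing R] [Algebra k R] [Module.Finite k R] [IsReduced R] [Field K] [IsAlgClosed K]
    [Algebra k K] : Module.finrank k R ≤ Fintype.card (R →ₐ[k] K) := by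
  classical
  haveI : IsArtinianRing R := IsArtinianRing.of_finite k R
  haveI : Fintype (MaximalSpectrum R) := Fintype.ofFinite _
  letI hfield : ∀ m : MaximalSpectrum R, Field (R ⧸ m.asIdeal) := fun m =>
    IsArtinianRing.fieldOfSubtypeIsMaximal R m
  haveI hfin : ∀ m : MaximalSpectrum R, Module.Finite k (R ⧸ m.asIdeal) := fun m =>
    Module.Finite.of_surjective (Ideal.Quotient.mkₐ k m.asIdeal).toLinearMap
      (Ideal.Quotient.mkₐ_surjective k m.asIdeal)
  haveI halg : ∀ m : MaximalSpectrum R, Algebra.IsAlgebraic k (R ⧸ m.asIdeal) := fun m =>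
    Algebra.IsAlgebraic.of_finite k _
  -- `dim_k R = ∑_𝔪 dim_k (R ⧸ 𝔪)`
  have hdim : Module.finrank k R = ∑ m : MaximalSpectrum R, Module.finrank k (R ⧸ m.asIdeal) := by
    rw [← Module.finrank_pi_fintype k]
    exact LinearEquiv.finrank_eq ((IsArtinianRing.equivPi R).toLinearEquiv.restrictScalars k)
  -- `dim_k (R ⧸ 𝔪) = #Hom_k(R ⧸ 𝔪, K)`
  have hcard : ∀ m : MaximalSpectrum R,
      Module.finrank k (R ⧸ m.asIdeal) = Fintype.card ((R ⧸ m.asIdeal) →ₐ[k] K) := fun m =>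
    (AlgHom.card k (R ⧸ m.asIdeal) K).symm
  -- the homomorphisms `ψ ∘ (R → R ⧸ 𝔪)` are pairwise distinct
  let Ψ : (Σ m : MaximalSpectrum R, ((R ⧸ m.asIdeal) →ₐ[k] K)) → (R →ₐ[k] K) := fun p =>
    p.2.comp (Ideal.Quotient.mkₐ k p.1.asIdeal)
  have hΨ : Function.Injective Ψ := by
    rintro ⟨m₁, ψ₁⟩ ⟨m₂, ψ₂⟩ h
    have hker : ∀ (m : MaximalSpectrum R) (ψ : (R ⧸ m.asIdeal) →ₐ[k] K),
        RingHom.ker (ψ.comp (Ideal.Quotient.mkₐ k m.asIdeal)).toRingHom = m.asIdeal := by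
      intro m ψ
      ext r
      rw [RingHom.mem_ker]
      change ψ (Ideal.Quotient.mk m.asIdeal r) = 0 ↔ _
      have hinj : Function.Injective ψ := ψ.toRingHom.injective
      rw [map_eq_zero_iff ψ hinj, Ideal.Quotient.eq_zero_iff_mem]
    have hm : m₁ = m₂ := by
      have h1 := hker m₁ ψ₁
      have h2 := hker m₂ ψ₂
      have h12 : (Ψ ⟨m₁, ψ₁⟩) = Ψ ⟨m₂, ψ₂⟩ := h
      simp only [Ψ] at h12
      rw [h12] at h1
      exact MaximalSpectrum.ext (h1.symm.trans h2)
    subst hm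
    have : ψ₁ = ψ₂ := by
      apply Ideal.Quotient.algHom_ext
      exact h
    subst this
    rfl
  calc Module.finrank k R = ∑ m : MaximalSpectrum R, Fintype.card ((R ⧸ m.asIdeal) →ₐ[k] K) := by
        rw [hdim]; exact Finset.sum_congr rfl fun m _ => hcard m
    _ = Fintype.card (Σ m : MaximalSpectrum R, ((R ⧸ m.asIdeal) →ₐ[k] K)) :=
        Fintype.card_sigma.symm
    _ ≤ Fintype.card (R →ₐ[k] K) := Fintype.card_le_of_injective Ψ hΨ


section Shape

variable {k K : Type*} [Field k] [Field K] [Algebra k K] {ι : Type*} [Fintype ι]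

/-- **The rational shape lemma** (Kronecker; Krick–Pardo 1996, Prop. 27 (1)–(2), as used by
Bürgisser 2000 TCS, proof of Thm. 4.5, p. 82: "the linear form `ℓ` separates the points of `V`"
and "`x_i = λ⁻¹ v_i(ℓ(x))` for all `x ∈ V`"; Rouillier 1999, Thm. 3.1). Let `k ⊆ K` be fields,
`k` perfect, `K` algebraically closed; let `V ⊆ K^ι` be a finite set which is the common zero set
of polynomials `F_j ∈ k[X_ι]`, with all coordinates of all points algebraic over `k`, and let
`ℓ : ι → k` be the coefficients of a linear form `∑ ℓ_i X_i` injective on `V`. Then there is a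
monic `μ ∈ k[T]` of degree `|V|` vanishing at each `ℓ(z)`, `z ∈ V`, with
`μ = ∏_{z ∈ V} (T - ℓ(z))` over `K`, and for every coordinate `i` a polynomial `v_i ∈ k[T]` of
degree `< |V|` with `z_i = v_i(ℓ(z))` for all `z ∈ V`.
[cite: Burgisser2000TCS, proof of Thm. 4.5 p. 82] -/
theorem exists_rational_shape [PerfectField k] [IsAlgClosed K] [DecidableEq ι] {σ : Type*}
    (F : σ → MvPolynomial ι k) (V : Finset (ι → K))
    (hV : ∀ z : ι → K, z ∈ V ↔ ∀ j, MvPolynomial.aeval z (F j) = 0)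
    (hint : ∀ z ∈ V, ∀ i, IsIntegral k (z i)) (ℓ : ι → k)
    (hsep : Set.InjOn (fun z : ι → K => ∑ i, algebraMap k K (ℓ i) * z i) (V : Set (ι → K))) :
    ∃ μ : k[X], μ.Monic ∧ μ.natDegree = V.card ∧
      (∀ z ∈ V, aeval (∑ i, algebraMap k K (ℓ i) * z i) μ = 0) ∧
      μ.map (algebraMap k K) = ∏ z ∈ V, (X - C (∑ i, algebraMap k K (ℓ i) * z i)) ∧
      ∀ i, ∃ v : k[X], v.degree < (V.card : WithBot ℕ) ∧
        ∀ z ∈ V, z i = aeval (∑ i', algebraMap k K (ℓ i') * z i') v := by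
  classical
  -- the value of the linear form
  set y : (ι → K) → K := fun z => ∑ i, algebraMap k K (ℓ i) * z i with hy
  -- the algebra of `K`-valued functions on `V`, the coordinate functions, the algebra they generate
  set A := (↥V → K) with hA
  set x : ι → A := fun i z => (z : ι → K) i with hx
  set R : Subalgebra k A := Algebra.adjoin k (Set.range x) with hR
  have hxR : ∀ i, x i ∈ R := fun i => Algebra.subset_adjoin ⟨i, rfl⟩
  -- evaluation at a point of `V`
  set ev : ↥V → (A →ₐ[k] K) := fun z => Pi.evalAlgHom k (fun _ : ↥V => K) z with hevdef
  have hev : ∀ (z : ↥V) (f : A), ev z f = f z := fun z f => rfl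
  have hevx : ∀ (z : ↥V) (i : ι), ev z (x i) = (z : ι → K) i := fun z i => rfl
  -- the generators are integral over `k`
  have hxint : ∀ i, IsIntegral k (x i) := by
    intro i
    refine ⟨∏ z ∈ V.attach, minpoly k ((z : ι → K) i),
      monic_prod_of_monic _ _ fun z _ => minpoly.monic (hint z z.2 i), ?_⟩
    rw [← Polynomial.aeval_def]
    funext z
    change ev z (aeval (x i) (∏ z' ∈ V.attach, minpoly k ((z' : ι → K) i))) = 0
    rw [← Polynomial.aeval_algHom_apply, map_prod, hevx]
    exact Finset.prod_eq_zero (Finset.mem_attach V z) (minpoly.aeval k _)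
  haveI : Module.Finite k R :=
    Algebra.finite_adjoin_of_finite_of_isIntegral (Set.finite_range x)
      (by rintro _ ⟨i, rfl⟩; exact hxint i)
  haveI : IsReduced R := isReduced_of_injective R.val Subtype.val_injective
  -- evaluation homomorphisms on `R`, and the point attached to a homomorphism
  set φ : ↥V → (R →ₐ[k] K) := fun z => (ev z).comp R.val with hφdef
  have hφx : ∀ (z : ↥V) (i : ι), φ z ⟨x i, hxR i⟩ = (z : ι → K) i := fun z i => rfl
  set pt : (R →ₐ[k] K) → (ι → K) := fun χ i => χ ⟨x i, hxR i⟩ with hptdef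
  have hFR : ∀ j, MvPolynomial.aeval (fun i => (⟨x i, hxR i⟩ : R)) (F j) = 0 := by
    intro j
    apply Subtype.ext
    change R.val (MvPolynomial.aeval (fun i => (⟨x i, hxR i⟩ : R)) (F j)) = 0
    rw [← AlgHom.comp_apply, MvPolynomial.comp_aeval]
    funext z
    change ev z (MvPolynomial.aeval (fun i => R.val ⟨x i, hxR i⟩) (F j)) = 0
    rw [← AlgHom.comp_apply, MvPolynomial.comp_aeval]
    exact (hV z).1 z.2 j
  have hpt_mem : ∀ χ, pt χ ∈ V := by
    intro χ
    rw [hV]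
    intro j
    have h1 : MvPolynomial.aeval (pt χ) (F j) =
        χ (MvPolynomial.aeval (fun i => (⟨x i, hxR i⟩ : R)) (F j)) := by
      rw [← AlgHom.comp_apply, MvPolynomial.comp_aeval]
    rw [h1, hFR, map_zero]
  have hpt_inj : Function.Injective pt := by
    intro χ₁ χ₂ h
    apply AlgHom.ext_of_eq_adjoin (S := R) rfl
    rintro _ ⟨i, rfl⟩
    exact congr_fun h i
  -- (A) `dim_k R ≤ N`
  have hAle : Module.finrank k R ≤ V.card := by
    calc Module.finrank k R ≤ Fintype.card (R →ₐ[k] K) :=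
          finrank_le_card_algHom_of_isReduced k R K
      _ ≤ Fintype.card ↥V := Fintype.card_le_of_injective (fun χ => ⟨pt χ, hpt_mem χ⟩)
          (fun χ₁ χ₂ h => hpt_inj (congrArg Subtype.val h))
      _ = V.card := Fintype.card_coe V
  -- the element `ℓR = ∑ ℓ_i x_i` of `R` and its minimal polynomial
  set ℓR : R := ∑ i, ℓ i • (⟨x i, hxR i⟩ : R) with hℓR
  have hφℓ : ∀ z : ↥V, φ z ℓR = y z := by
    intro z
    simp only [hℓR, map_sum, Algebra.smul_def, map_mul, AlgHom.commutes, hφx, hy]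
  have hℓint : IsIntegral k ℓR := (Algebra.IsIntegral.of_finite k R).isIntegral ℓR
  set μ := minpoly k ℓR with hμ
  have hμmonic : μ.Monic := minpoly.monic hℓint
  have hμroot : ∀ z : ↥V, aeval (y z) μ = 0 := by
    intro z
    rw [← hφℓ, Polynomial.aeval_algHom_apply, hμ, minpoly.aeval, map_zero]
  have hμK : μ.map (algebraMap k K) ≠ 0 := (hμmonic.map _).ne_zero
  have hnd : (V.val.map y).Nodup := V.nodup.map_on fun a ha b hb h => hsep ha hb h
  have hle : V.val.map y ≤ (μ.map (algebraMap k K)).roots := by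
    rw [Multiset.le_iff_subset hnd]
    intro t ht
    obtain ⟨z, hz, rfl⟩ := Multiset.mem_map.1 ht
    rw [mem_roots hμK, IsRoot.def, eval_map, ← aeval_def]
    exact hμroot ⟨z, hz⟩
  -- (B) `N ≤ deg μ`
  have hBle : V.card ≤ μ.natDegree := by
    calc V.card = Multiset.card (V.val.map y) := by rw [Multiset.card_map]; rfl
      _ ≤ Multiset.card (μ.map (algebraMap k K)).roots := Multiset.card_le_card hle
      _ ≤ (μ.map (algebraMap k K)).natDegree := card_roots' _
      _ = μ.natDegree := natDegree_map _
  -- (C) `deg μ ≤ dim_k k[ℓR] ≤ dim_k R`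
  set S : Subalgebra k R := Algebra.adjoin k {ℓR} with hSdef
  have hmemS : ∀ n : ℕ, ℓR ^ n ∈ S := fun n => pow_mem (Algebra.self_mem_adjoin_singleton k ℓR) n
  have hCle : μ.natDegree ≤ Module.finrank k S := by
    have hli : LinearIndependent k (fun i : Fin μ.natDegree => (⟨ℓR ^ (i : ℕ), hmemS i⟩ : S)) := by
      apply LinearIndependent.of_comp S.val.toLinearMap
      exact linearIndependent_pow (K := k) ℓR
    simpa using hli.fintype_card_le_finrank
  have hSR : Module.finrank k S ≤ Module.finrank k R :=
    Submodule.finrank_le (Subalgebra.toSubmodule S)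
  have hdegN : μ.natDegree = V.card := le_antisymm (hCle.trans (hSR.trans hAle)) hBle
  have hS : S = ⊤ := by
    have hfin : Module.finrank k (Subalgebra.toSubmodule S) = Module.finrank k R := by
      rw [Subalgebra.finrank_toSubmodule]; omega
    exact Algebra.toSubmodule_eq_top.1 (Submodule.eq_top_of_finrank_eq hfin)
  -- every coordinate function is a polynomial in `ℓR` of degree `< N`
  have hxS : ∀ i, ∃ v : k[X], v.degree < (V.card : WithBot ℕ) ∧ aeval ℓR v = (⟨x i, hxR i⟩ : R) := by
    intro i
    have hmem : (⟨x i, hxR i⟩ : R) ∈ S := by rw [hS]; exact Algebra.mem_top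
    rw [hSdef, Algebra.adjoin_singleton_eq_range_aeval] at hmem
    obtain ⟨v, hv⟩ := hmem
    refine ⟨v %ₘ μ, ?_, ?_⟩
    · calc (v %ₘ μ).degree < μ.degree := degree_modByMonic_lt v hμmonic
        _ = V.card := by rw [degree_eq_natDegree hμmonic.ne_zero, hdegN]
    · rw [hμ, minpoly.aeval_modByMonic_minpoly]; exact hv
  refine ⟨μ, hμmonic, hdegN, fun z hz => hμroot ⟨z, hz⟩, ?_, fun i => ?_⟩
  · refine eq_of_monic_of_dvd_of_natDegree_le
      (monic_prod_of_monic _ _ fun z _ => monic_X_sub_C (y z)) (hμmonic.map _) ?_ ?_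
    · have : (∏ z ∈ V, (X - C (y z))) = ((V.val.map y).map fun a => X - C a).prod := by
        rw [Finset.prod_eq_multiset_prod, Multiset.map_map]; rfl
      rw [this, Multiset.prod_X_sub_C_dvd_iff_le_roots hμK]
      exact hle
    · rw [natDegree_map, hdegN, natDegree_prod_of_monic _ _ fun z _ => monic_X_sub_C (y z)]
      simp
  · obtain ⟨v, hvdeg, hv⟩ := hxS i
    refine ⟨v, hvdeg, fun z hz => ?_⟩
    calc z i = φ ⟨z, hz⟩ ⟨x i, hxR i⟩ := (hφx ⟨z, hz⟩ i).symm
      _ = φ ⟨z, hz⟩ (aeval ℓR v) := by rw [hv]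
      _ = aeval (φ ⟨z, hz⟩ ℓR) v := (Polynomial.aeval_algHom_apply _ _ _).symm
      _ = aeval (y z) v := by rw [hφℓ]

end Shape

end Literature.RingTheory.ZeroDimensional

end
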